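import Literature.Analysis.FluidPDE.NSBoundedTimeHolderTop
import HarnessLib

/-!
# Hölder continuity in space–time up to the top, with the constants fixed before the solution

Analysis/FluidPDE proofs file (theorems only; no definitions, no named facts). The accepted
`SliceTimeHolder.exists_holderOnWith_representative` (`NSBoundedTimeHolderTop.lean`; folklore,
the role of the pressure as in Robinson–Rodrigo–Sadowski 2016, §13.5; Escauriaza–Seregin–Šverák
2003, Lemma 2.2) turns `(C, α)`-Hölder slices of an essentially bounded distributional
Navier–Stokes solution with `L_{3/2}` pressure on a centred cylinder `Q*_R(z)` into a
representative which is Hölder continuous on `]t₀ - R², t₀ + R²[ × B(x₀, r)`, `r < R`, for the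
product metric — with constants produced *after* the solution (`∃ W K κ`). Its proof is
quantitative, and this file records the statement **with `K`, `κ` chosen before the solution**,
as functions of `R`, `r`, the velocity bound `M`, a bound `P₀` of `∫∫ |p|^{3/2}` and the slice
constants `C`, `α` (the form consumed by Seregin–Šverák 2009, arXiv:0804.1803, §2 p. 8 / §4
p. 11: "the corresponding norms are estimated by constants depending on the data"):

* `SliceTimeHolderQuant.time_modulus_of_scales_explicit` — the accepted
  `SliceTimeHolder.time_modulus_of_scales` with its constant
  `K_t = 6C + 96 A₀ (1 + Λ) + 2|M| / (δ₀^{30})^κ`, `κ = min(α/30, 1/6)`, displayed;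
* `SliceTimeHolderQuant.exists_holderOnWith_representative_quant` —
  `∀ r < R, M, P₀, C, α ∃ K κ ∀ (u, p, z) …`.

## Proof

Verbatim the accepted proof, with the universal bump constants `k₁, k₂`
(`SliceTimeHolder.exists_scaled_bump_bounds`), `δ₀ = min(1, (R - r)/2)`,
`A₀ = |B_R| (k₁ M² + k₂ |M|) + 3 k₁`, `Λ = (P₀^{2/3} |B_R|^{1/3})` (an upper bound of the printed
`|B_R|^{1/3} ‖p‖_{L_{3/2}}`, which is all `time_modulus_of_scales` uses) and `κ` fixed first;
`|B(x₀, R)| = |B(0, R)|` by translation invariance.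

## References

* J. C. Robinson, J. L. Rodrigo, W. Sadowski, *The three-dimensional Navier–Stokes equations*
  (CUP 2016), §13.5. [`RobinsonRodrigoSadowskiCUP2016`]
* L. Escauriaza, G. Seregin, V. Šverák, Russ. Math. Surveys 58 (2003), Lemma 2.2.
  [`EscauriazaSereginSverak2003`]
* G. Seregin, V. Šverák, Comm. PDE 34 (2009) = arXiv:0804.1803, §2 p. 8, §4 p. 11.
  [`SereginSverak2009`]
-/

noncomputable section

open MeasureTheory Set Function Filter Topology TopologicalSpace Metric
open scoped NNReal ENNReal InnerProductSpace RealInnerProductSpace Laplacian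

namespace Literature.Analysis.FluidPDE

namespace SliceTimeHolderQuant

open SliceTimeHolder

/-- **From the modulus at all dyadic-like scales to a Hölder modulus in time, with the constant
displayed.** The accepted `SliceTimeHolder.time_modulus_of_scales` with its constant
`K_t = 6C + 96 A₀ (1 + Λ) + 2|M| / (δ₀^{30})^κ`, `κ = min(α/30, 1/6)`, in the statement (same
proof). [folklore] -/
theorem time_modulus_of_scales_explicit {vT : ℝ → EuclideanSpace ℝ (Fin 3) → EuclideanSpace ℝ (Fin 3)}
    {T : Set ℝ} {B' : Set (EuclideanSpace ℝ (Fin 3))} {P : ℝ → ℝ} {δ₀ A₀ Λ M : ℝ} {C α : ℝ≥0}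
    (hδ₀0 : 0 < δ₀) (hδ₀1 : δ₀ ≤ 1) (hA₀ : 0 ≤ A₀) (hΛ : 0 ≤ Λ)
    (hkey : ∀ n : ℕ, ∀ t ∈ T, ∀ s ∈ T, ∀ y ∈ B',
      ‖vT t y - vT s y‖ ≤ 6 * C * (δ₀ / ((n : ℝ) + 1)) ^ (α : ℝ) +
        3 * (A₀ / (δ₀ / ((n : ℝ) + 1)) ^ 5) * |P t - P s|)
    (hP : ∀ t ∈ T, ∀ s ∈ T, |P t - P s| ≤ |t - s| + Λ * |t - s| ^ (1 / 3 : ℝ))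
    (hvM : ∀ t ∈ T, ∀ y ∈ B', ‖vT t y‖ ≤ M) :
    ∀ t ∈ T, ∀ s ∈ T, ∀ y ∈ B',
      ‖vT t y - vT s y‖ ≤ (6 * C + 96 * A₀ * (1 + Λ) +
        2 * |M| / (δ₀ ^ (30 : ℝ)) ^ ((min (α / 30) (1 / 6) : ℝ≥0) : ℝ)) *
        |t - s| ^ ((min (α / 30) (1 / 6) : ℝ≥0) : ℝ) := by
  set κ : ℝ≥0 := min (α / 30) (1 / 6) with hκ
  have hκα : (κ : ℝ) ≤ (α : ℝ) / 30 := by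
    have : κ ≤ α / 30 := min_le_left _ _
    exact_mod_cast this
  have hκ6 : (κ : ℝ) ≤ 1 / 6 := by
    have : κ ≤ 1 / 6 := min_le_right _ _
    exact_mod_cast this
  set τ₀ : ℝ := δ₀ ^ (30 : ℝ) with hτ₀
  have hτ₀0 : 0 < τ₀ := Real.rpow_pos_of_pos hδ₀0 _
  have hτ₀1 : τ₀ ≤ 1 := Real.rpow_le_one hδ₀0.le hδ₀1 (by norm_num)
  set Kt : ℝ := 6 * C + 96 * A₀ * (1 + Λ) + 2 * |M| / τ₀ ^ (κ : ℝ) with hKt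
  have hKt0 : 0 ≤ Kt := by rw [hKt]; positivity
  intro t ht s hs y hy
  set τ : ℝ := |t - s| with hτ
  have hτnn : 0 ≤ τ := abs_nonneg _
  rcases hτnn.eq_or_lt with hτ0 | hτpos
  · -- `t = s`
    have hts : t - s = 0 := abs_eq_zero.1 hτ0.symm
    have : t = s := by linarith
    subst this
    rw [sub_self, norm_zero]
    positivity
  by_cases hsmall : τ ≤ τ₀
  · -- the bump radius `d = τ^{1/30} ≤ δ₀`, realised within a factor two by some `δₙ`
    have hτ1 : τ ≤ 1 := hsmall.trans hτ₀1
    set d : ℝ := τ ^ (1 / 30 : ℝ) with hd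
    have hdpos : 0 < d := Real.rpow_pos_of_pos hτpos _
    have hdδ₀ : d ≤ δ₀ := by
      have h := Real.rpow_le_rpow hτnn hsmall (by norm_num : (0 : ℝ) ≤ 1 / 30)
      rw [hτ₀, ← Real.rpow_mul hδ₀0.le] at h
      norm_num at h
      exact h
    obtain ⟨n, hn1, hn2⟩ := exists_nat_radius_near hdpos hdδ₀
    set δn : ℝ := δ₀ / ((n : ℝ) + 1) with hδn
    have hδn0 : 0 < δn := by positivity
    have hk := hkey n t ht s hs y hy
    -- `|P t - P s| ≤ (1 + Λ) τ^{1/3}`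
    have hP13 : |P t - P s| ≤ (1 + Λ) * τ ^ (1 / 3 : ℝ) := by
      have h1 : τ ≤ τ ^ (1 / 3 : ℝ) := by
        have := Real.rpow_le_rpow_of_exponent_ge hτpos hτ1 (by norm_num : (1 / 3 : ℝ) ≤ 1)
        rwa [Real.rpow_one] at this
      calc |P t - P s| ≤ τ + Λ * τ ^ (1 / 3 : ℝ) := hP t ht s hs
        _ ≤ τ ^ (1 / 3 : ℝ) + Λ * τ ^ (1 / 3 : ℝ) := by linarith
        _ = (1 + Λ) * τ ^ (1 / 3 : ℝ) := by ring
    -- first term: `6 C δₙ^α ≤ 6 C d^α = 6 C τ^{α/30} ≤ 6 C τ^κ`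
    have hterm1 : 6 * (C : ℝ) * δn ^ (α : ℝ) ≤ 6 * C * τ ^ (κ : ℝ) := by
      have h1 : δn ^ (α : ℝ) ≤ d ^ (α : ℝ) := Real.rpow_le_rpow hδn0.le hn2 α.2
      have h2 : d ^ (α : ℝ) = τ ^ ((α : ℝ) / 30) := by
        rw [hd, ← Real.rpow_mul hτnn]; ring_nf
      have h3 : τ ^ ((α : ℝ) / 30) ≤ τ ^ (κ : ℝ) :=
        Real.rpow_le_rpow_of_exponent_ge hτpos hτ1 hκα
      calc 6 * (C : ℝ) * δn ^ (α : ℝ) ≤ 6 * C * d ^ (α : ℝ) := by gcongr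
        _ ≤ 6 * C * τ ^ (κ : ℝ) := by rw [h2]; gcongr
    -- second term: `3 (A₀ δₙ⁻⁵) |P t - P s| ≤ 96 A₀ (1 + Λ) τ^{1/3 - 1/6} ≤ 96 A₀ (1 + Λ) τ^κ`
    have hterm2 : 3 * (A₀ / δn ^ 5) * |P t - P s| ≤ 96 * A₀ * (1 + Λ) * τ ^ (κ : ℝ) := by
      have hδn5 : (d / 2) ^ 5 ≤ δn ^ 5 := pow_le_pow_left₀ (by positivity) hn1 5
      have hd5 : (d / 2) ^ 5 = τ ^ (1 / 6 : ℝ) / 32 := by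
        rw [div_pow, hd, ← Real.rpow_natCast, ← Real.rpow_mul hτnn]
        norm_num
      have hτ16 : 0 < τ ^ (1 / 6 : ℝ) := Real.rpow_pos_of_pos hτpos _
      have hA_le : A₀ / δn ^ 5 ≤ 32 * A₀ / τ ^ (1 / 6 : ℝ) := by
        calc A₀ / δn ^ 5 ≤ A₀ / (d / 2) ^ 5 := div_le_div_of_nonneg_left hA₀ (by positivity) hδn5
          _ = 32 * A₀ / τ ^ (1 / 6 : ℝ) := by rw [hd5]; field_simp
      calc 3 * (A₀ / δn ^ 5) * |P t - P s|
          ≤ 3 * (32 * A₀ / τ ^ (1 / 6 : ℝ)) * ((1 + Λ) * τ ^ (1 / 3 : ℝ)) := by gcongr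
        _ = 96 * A₀ * (1 + Λ) * (τ ^ (1 / 3 : ℝ) / τ ^ (1 / 6 : ℝ)) := by ring
        _ = 96 * A₀ * (1 + Λ) * τ ^ (1 / 6 : ℝ) := by
            rw [← Real.rpow_sub hτpos]; norm_num
        _ ≤ 96 * A₀ * (1 + Λ) * τ ^ (κ : ℝ) :=
            mul_le_mul_of_nonneg_left (Real.rpow_le_rpow_of_exponent_ge hτpos hτ1 hκ6)
              (by positivity)
    have h3 : 0 ≤ 2 * |M| / τ₀ ^ (κ : ℝ) * τ ^ (κ : ℝ) := by positivity
    calc ‖vT t y - vT s y‖ ≤ 6 * C * δn ^ (α : ℝ) + 3 * (A₀ / δn ^ 5) * |P t - P s| := hk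
      _ ≤ 6 * C * τ ^ (κ : ℝ) + 96 * A₀ * (1 + Λ) * τ ^ (κ : ℝ) := add_le_add hterm1 hterm2
      _ ≤ Kt * τ ^ (κ : ℝ) := by rw [hKt]; nlinarith
  · -- large gaps: the sup bound
    have hτ₀τ : τ₀ < τ := lt_of_not_ge hsmall
    have h1 : ‖vT t y - vT s y‖ ≤ 2 * |M| :=
      calc ‖vT t y - vT s y‖ ≤ ‖vT t y‖ + ‖vT s y‖ := norm_sub_le _ _
        _ ≤ M + M := add_le_add (hvM t ht y hy) (hvM s hs y hy)
        _ ≤ 2 * |M| := by linarith [le_abs_self M]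
    have h2 : τ₀ ^ (κ : ℝ) ≤ τ ^ (κ : ℝ) := Real.rpow_le_rpow hτ₀0.le hτ₀τ.le κ.2
    have hτ₀κ : 0 < τ₀ ^ (κ : ℝ) := Real.rpow_pos_of_pos hτ₀0 _
    have h3 : 2 * |M| ≤ 2 * |M| / τ₀ ^ (κ : ℝ) * τ ^ (κ : ℝ) := by
      rw [div_mul_eq_mul_div, le_div_iff₀ hτ₀κ]
      exact mul_le_mul_of_nonneg_left h2 (by positivity)
    have h4 : 2 * |M| / τ₀ ^ (κ : ℝ) * τ ^ (κ : ℝ) ≤ Kt * τ ^ (κ : ℝ) := by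
      refine mul_le_mul_of_nonneg_right ?_ (by positivity)
      rw [hKt]
      have : 0 ≤ 6 * (C : ℝ) + 96 * A₀ * (1 + Λ) := by positivity
      linarith
    linarith

/-- **Bounded local weak solutions with Hölder slices are Hölder in space–time up to both ends of
the time window, with the constants fixed before the solution** (quantitative form of the
accepted `SliceTimeHolder.exists_holderOnWith_representative`; folklore, Robinson–Rodrigo–
Sadowski 2016, §13.5; the dependence on the data as in Seregin–Šverák 2009, §2 p. 8). For
`0 < r < R`, `M`, `P₀`, `C`, `α > 0` there are `K`, `κ > 0` such that: whenever `(u, p)` solves the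
Navier–Stokes system (`ν = 1`, no force) in the sense of distributions in `Q*_R(z) = I × B`,
with `|u| ≤ M` a.e., `∫∫ |p|^{3/2} ≤ P₀`, and for a.e. `t ∈ I` the slice `u(t, ·)` agrees a.e. on
`B` with a `(C, α)`-Hölder field, then `u` agrees a.e. on `I × B(x₀, r)` with a function `W`
which is `(K, κ)`-Hölder there for the product metric of `ℝ × ℝ³`. Proof: module docstring.
[cite: RobinsonRodrigoSadowskiCUP2016, §13.5 (time regularity through the pressure); SereginSverak2009 §2 p. 8; folklore] -/
theorem exists_holderOnWith_representative_quant {R r : ℝ} (hr0 : 0 < r) (hrR : r < R)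
    (M : ℝ) (P₀ : ℝ≥0) (C α : ℝ≥0) (hα : 0 < α) :
    ∃ K κ : ℝ≥0, 0 < κ ∧
      ∀ (u : ℝ → EuclideanSpace ℝ (Fin 3) → EuclideanSpace ℝ (Fin 3))
        (p : ℝ → EuclideanSpace ℝ (Fin 3) → ℝ) (z : ℝ × EuclideanSpace ℝ (Fin 3)),
      IsDistributionalNSSolutionOn (parabolicCylinderCenteredOpens R z) 1 0 u p →
      (∀ᵐ w ∂(volume.restrict (parabolicCylinderCentered R z)), ‖u w.1 w.2‖ ≤ M) →
      (∫⁻ w in parabolicCylinderCentered R z, ‖p w.1 w.2‖ₑ ^ (3 / 2 : ℝ) ≤ P₀) →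
      (∀ᵐ t ∂(volume.restrict (Ioo (z.1 - R ^ 2) (z.1 + R ^ 2))),
        ∃ v : EuclideanSpace ℝ (Fin 3) → EuclideanSpace ℝ (Fin 3),
          HolderOnWith C α v (ball z.2 R) ∧ u t =ᵐ[volume.restrict (ball z.2 R)] v) →
      ∃ W : ℝ × EuclideanSpace ℝ (Fin 3) → EuclideanSpace ℝ (Fin 3),
        HolderOnWith K κ W (Ioo (z.1 - R ^ 2) (z.1 + R ^ 2) ×ˢ ball z.2 r) ∧
        uncurry u =ᵐ[volume.restrict (Ioo (z.1 - R ^ 2) (z.1 + R ^ 2) ×ˢ ball z.2 r)] W := by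
  have hR0 : 0 < R := hr0.trans hrR
  -- the constants, fixed before the solution
  obtain ⟨k₁, k₂, hk₁, hk₂, hfam⟩ := exists_scaled_bump_bounds
  set δ₀ : ℝ := min 1 ((R - r) / 2) with hδ₀
  have hδ₀0 : 0 < δ₀ := lt_min one_pos (by linarith)
  have hδ₀1 : δ₀ ≤ 1 := min_le_left _ _
  have hδ₀R : δ₀ < R - r := (min_le_right _ _).trans_lt (by linarith)
  set VB : ℝ := (volume (ball (0 : EuclideanSpace ℝ (Fin 3)) R)).toReal with hVB
  have hvolB : 0 ≤ VB := ENNReal.toReal_nonneg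
  set A₀ : ℝ := VB * (k₁ * M ^ 2 + k₂ * |M|) + 3 * k₁ with hA₀
  have hA₀0 : 0 ≤ A₀ := by
    have : 0 ≤ k₁ * M ^ 2 + k₂ * |M| := by positivity
    rw [hA₀]; positivity
  set Λ : ℝ := (((P₀ : ℝ≥0∞) ^ (2 / 3 : ℝ)) *
    volume (ball (0 : EuclideanSpace ℝ (Fin 3)) R) ^ (1 / 3 : ℝ)).toReal with hΛ
  have hΛ0 : 0 ≤ Λ := ENNReal.toReal_nonneg
  set κ : ℝ≥0 := min (α / 30) (1 / 6) with hκ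
  have hκ0 : 0 < κ := lt_min (by positivity) (by norm_num)
  have hκα : κ ≤ α := (min_le_left _ _).trans (by
    rw [div_le_iff₀ (by norm_num : (0 : ℝ≥0) < 30)]
    have : (1 : ℝ≥0) ≤ 30 := by norm_num
    calc α = α * 1 := (mul_one α).symm
      _ ≤ α * 30 := by gcongr)
  set Kt : ℝ := 6 * C + 96 * A₀ * (1 + Λ) + 2 * |M| / (δ₀ ^ (30 : ℝ)) ^ ((κ : ℝ≥0) : ℝ) with hKt
  have hKt0 : 0 ≤ Kt := by rw [hKt]; positivity
  refine ⟨(Kt + C + 2 * |M|).toNNReal, κ, hκ0, ?_⟩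
  intro u p z hsol hbd hpP hH
  have hp : ∫⁻ w in parabolicCylinderCentered R z, ‖p w.1 w.2‖ₑ ^ (3 / 2 : ℝ) < ∞ :=
    lt_of_le_of_lt hpP ENNReal.coe_lt_top
  set a : ℝ := z.1 - R ^ 2 with ha
  set b : ℝ := z.1 + R ^ 2 with hb
  set B : Set (EuclideanSpace ℝ (Fin 3)) := ball z.2 R with hB
  set B' : Set (EuclideanSpace ℝ (Fin 3)) := ball z.2 r with hB'
  have hB'B : B' ⊆ B := ball_subset_ball hrR.le
  have hpi : IntegrableOn (uncurry p) (parabolicCylinderCentered R z) volume :=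
    integrableOn_pressure_of_lintegral hsol hp
  -- the bump scales `δ n = δ₀/(n+1)`
  set δ : ℕ → ℝ := fun n => δ₀ / ((n : ℝ) + 1) with hδ
  have hδ0 : ∀ n, 0 < δ n := fun n => by positivity
  have hδle : ∀ n, δ n ≤ δ₀ := fun n => by
    rw [hδ]
    exact div_le_self hδ₀0.le (by linarith [n.cast_nonneg (α := ℝ)])
  have hδ1 : ∀ n, δ n ≤ 1 := fun n => (hδle n).trans hδ₀1
  have hδlt : ∀ n, δ n < R - r := fun n => (hδle n).trans_lt hδ₀R
  have hφex : ∀ n, ∃ φ : ContDiffBump (0 : EuclideanSpace ℝ (Fin 3)), φ.rOut = δ n ∧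
      ∀ (v q x : EuclideanSpace ℝ (Fin 3)),
        ‖fderiv ℝ (fun y => φ.normed volume (y - q) • v) x‖ ≤ k₁ * ‖v‖ / δ n ^ 4 ∧
        ‖Δ (fun y => φ.normed volume (y - q) • v) x‖ ≤ k₂ * ‖v‖ / δ n ^ 5 :=
    fun n => hfam (δ n) (hδ0 n) (hδ1 n)
  choose φ hφ hφbd using hφex
  -- the basis vectors and a dense sequence of centres
  set e := EuclideanSpace.basisFun (Fin 3) ℝ with he
  obtain ⟨q, hq⟩ := TopologicalSpace.exists_dense_seq (EuclideanSpace ℝ (Fin 3))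
  -- the test fields, their quantitative bounds, and the test property for centres in `B'`
  set η : ℕ → ℕ → Fin 3 → (EuclideanSpace ℝ (Fin 3)) → (EuclideanSpace ℝ (Fin 3)) :=
    fun n k i y => (φ n).normed volume (y - q k) • e i with hη
  set K₁ : ℕ → ℝ := fun n => k₁ / δ n ^ 4 with hK₁d
  set K₂ : ℕ → ℝ := fun n => k₂ / δ n ^ 5 with hK₂d
  have hK₁ : ∀ n k i x, ‖fderiv ℝ (η n k i) x‖ ≤ K₁ n := fun n k i x => by
    have h := (hφbd n (e i) (q k) x).1
    rwa [show ‖e i‖ = 1 from e.norm_eq_one i, mul_one] at h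
  have hK₂ : ∀ n k i x, ‖Δ (η n k i) x‖ ≤ K₂ n := fun n k i x => by
    have h := (hφbd n (e i) (q k) x).2
    rwa [show ‖e i‖ = 1 from e.norm_eq_one i, mul_one] at h
  have hcb : ∀ n k, q k ∈ B' → closedBall (q k) (φ n).rOut ⊆ B := by
    intro n k hk x hx
    rw [mem_closedBall, hφ] at hx
    rw [hB', mem_ball] at hk
    rw [hB, mem_ball]
    linarith [dist_triangle x (q k) z.2, hδlt n]
  have htest : ∀ n k i, q k ∈ B' →
      FunctionSpaces.IsTestFunctionOn ⟨B, isOpen_ball⟩ (η n k i) := fun n k i hk =>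
    isTestFunctionOn_bump_smul (φ n) (q k) (e i) isOpen_ball (hcb n k hk)
  -- pairings, remainders, primitives, pressure clock, constants
  set g : ℕ → ℕ → Fin 3 → ℝ → ℝ := fun n k i t => ∫ x in B, ⟪u t x, η n k i x⟫ with hg
  set F : ℕ → ℕ → Fin 3 → ℝ → ℝ := fun n k i s => ∫ x in B,
    (⟪u s x, fderiv ℝ (η n k i) x (u s x)⟫ + ⟪u s x, Δ (η n k i) x⟫ +
      p s x * VectorCalculus.divergence (η n k i) x) with hF
  set V : ℕ → ℕ → Fin 3 → ℝ → ℝ := fun n k i t => ∫ s in Ioc a t, F n k i s with hV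
  set P : ℝ → ℝ := fun t => ∫ s in Ioc a t, (1 + ∫ x in B, |p s x|) with hP
  set A : ℕ → ℝ := fun n =>
    |(volume B).toReal * (K₁ n * M ^ 2 + K₂ n * M)| + 3 * |K₁ n| with hA
  -- Step 1: the a.e. representations and the increment bounds
  have hrep : ∀ n k i, ∃ c : ℝ, q k ∈ B' → ∀ᵐ t ∂(volume.restrict (Ioo a b)),
      g n k i t = c + V n k i t := by
    intro n k i
    by_cases hk : q k ∈ B'
    · obtain ⟨c, hc⟩ := exists_ae_pairing_eq_const_add_primitive hsol hbd hpi (htest n k i hk)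
      exact ⟨c, fun _ => hc⟩
    · exact ⟨0, fun h => absurd h hk⟩
  choose c hc using hrep
  have hinc : ∀ n k i, q k ∈ B' → ∀ t ∈ Icc a b, ∀ s ∈ Icc a b,
      |V n k i t - V n k i s| ≤ A n * |P t - P s| := fun n k i hk t ht s hs =>
    abs_primitive_sub_primitive_le hsol hbd hpi (htest n k i hk) (hK₁ n k i) (hK₂ n k i) ht hs
  -- Step 2: the good set of times (Hölder slice, slice bound, all pairing identities)
  have hbds : ∀ᵐ t ∂(volume.restrict (Ioo a b)), ∀ᵐ x ∂(volume.restrict B), ‖u t x‖ ≤ M :=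
    ae_ae_norm_slice_le hbd
  set T : Set ℝ := {t | t ∈ Ioo a b ∧
    (∃ v : (EuclideanSpace ℝ (Fin 3)) → (EuclideanSpace ℝ (Fin 3)),
      HolderOnWith C α v B ∧ u t =ᵐ[volume.restrict B] v) ∧
    (∀ᵐ x ∂(volume.restrict B), ‖u t x‖ ≤ M) ∧
    ∀ n k i, q k ∈ B' → g n k i t = c n k i + V n k i t} with hT
  have hTfull : ∀ᵐ t ∂(volume.restrict (Ioo a b)), t ∈ T := by
    have h1 : ∀ᵐ t ∂(volume.restrict (Ioo a b)), t ∈ Ioo a b := ae_restrict_mem measurableSet_Ioo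
    have h3 : ∀ᵐ t ∂(volume.restrict (Ioo a b)), ∀ n k i, q k ∈ B' →
        g n k i t = c n k i + V n k i t := by
      rw [ae_all_iff]; intro n
      rw [ae_all_iff]; intro k
      rw [ae_all_iff]; intro i
      by_cases hk : q k ∈ B'
      · filter_upwards [hc n k i hk] with t ht _ using ht
      · exact Eventually.of_forall fun t h => absurd h hk
    filter_upwards [h1, hH, hbds, h3] with t h1t h2t h4t h3t
    exact ⟨h1t, h2t, h4t, h3t⟩
  have hTI : T ⊆ Ioo a b := fun t ht => ht.1
  have hTcl : Ioo a b ⊆ closure T := subset_closure_of_ae_restrict_mem isOpen_Ioo hTfull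
  -- Step 3: the Hölder representatives at good times, and their sup bound
  have hvex : ∀ t, ∃ v : (EuclideanSpace ℝ (Fin 3)) → (EuclideanSpace ℝ (Fin 3)), t ∈ T →
      HolderOnWith C α v B ∧ u t =ᵐ[volume.restrict B] v := by
    intro t
    by_cases ht : t ∈ T
    · obtain ⟨v, hv⟩ := ht.2.1
      exact ⟨v, fun _ => hv⟩
    · exact ⟨0, fun h => absurd h ht⟩
  choose vT hvT using hvex
  have hgv : ∀ t ∈ T, ∀ n k i, g n k i t = ∫ x in B, ⟪vT t x, η n k i x⟫ := by
    intro t ht n k i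
    refine integral_congr_ae ?_
    filter_upwards [(hvT t ht).2] with x hx
    rw [hx]
  -- an a.e. bound on a continuous function on the (open) ball holds everywhere
  have hnormle : ∀ {f : EuclideanSpace ℝ (Fin 3) → EuclideanSpace ℝ (Fin 3)},
      ContinuousOn f B → (∀ᵐ x ∂(volume.restrict B), ‖f x‖ ≤ M) → ∀ x ∈ B, ‖f x‖ ≤ M := by
    intro f hf h
    by_contra hcon
    push Not at hcon
    obtain ⟨x, hxB, hx⟩ := hcon
    have hopen : IsOpen (B ∩ (fun w => ‖f w‖) ⁻¹' Ioi M) :=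
      hf.norm.isOpen_inter_preimage isOpen_ball isOpen_Ioi
    have hpos : 0 < volume (B ∩ (fun w => ‖f w‖) ⁻¹' Ioi M) :=
      hopen.measure_pos volume ⟨x, hxB, hx⟩
    have hnull : volume.restrict B {w | ¬‖f w‖ ≤ M} = 0 := ae_iff.1 h
    rw [Measure.restrict_apply' measurableSet_ball] at hnull
    have hsub : B ∩ (fun w => ‖f w‖) ⁻¹' Ioi M ⊆ {w | ¬‖f w‖ ≤ M} ∩ B :=
      fun w hw => ⟨not_le.2 hw.2, hw.1⟩
    exact hpos.ne' (measure_mono_null hsub hnull)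
  have hvM : ∀ t ∈ T, ∀ y ∈ B, ‖vT t y‖ ≤ M := by
    intro t ht
    refine hnormle ((hvT t ht).1.continuousOn hα) ?_
    filter_upwards [ht.2.2.1, (hvT t ht).2] with x hx hx'
    rw [← hx']
    exact hx
  -- Step 4: the key estimate between two good slices, for every bump scale
  have hkey : ∀ n, ∀ t ∈ T, ∀ s ∈ T, ∀ y ∈ B',
      ‖vT t y - vT s y‖ ≤ 6 * C * δ n ^ ((α : ℝ)) + (∑ _i : Fin 3, A n) * |P t - P s| := by
    intro n t ht s hs y hy
    have hφn : (φ n).rOut < R - r := by rw [hφ]; exact hδlt n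
    have key := norm_sub_le_of_bump_pairings hα (hvT t ht).1 (hvT s hs).1 (φ n) hφn hq
      (A := fun _ => A n) (D := |P t - P s|) (fun k i hk => ?_) hy
    · rw [hφ] at key
      exact key
    · show |(∫ x in B, ⟪vT t x, η n k i x⟫) - ∫ x in B, ⟪vT s x, η n k i x⟫| ≤ A n * |P t - P s|
      rw [← hgv t ht n k i, ← hgv s hs n k i, ht.2.2.2 n k i hk, hs.2.2.2 n k i hk,
        add_sub_add_left_eq_sub]
      exact hinc n k i hk t (Ioo_subset_Icc_self ht.1) s (Ioo_subset_Icc_self hs.1)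
  -- Step 5: the pressure clock is continuous; uniformly Cauchy; the continuous limit `W`
  have hPc : ∀ τ ∈ Ioo a b, ContinuousAt P τ := fun τ hτ =>
    (continuousOn_pressureClock hpi).continuousAt (Icc_mem_nhds hτ.1 hτ.2)
  have hδlim : Tendsto δ atTop (𝓝 0) := by
    have h1 : Tendsto (fun n : ℕ => (n : ℝ) + 1) atTop atTop :=
      tendsto_atTop_add_const_right _ 1 tendsto_natCast_atTop_atTop
    exact tendsto_const_nhds.div_atTop h1
  have hω : Tendsto (fun n => 6 * (C : ℝ) * δ n ^ (α : ℝ)) atTop (𝓝 0) := by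
    have h1 : Tendsto (fun n => δ n ^ (α : ℝ)) atTop (𝓝 0) := by
      have := hδlim.rpow_const (p := (α : ℝ)) (Or.inr α.2)
      rwa [Real.zero_rpow (NNReal.coe_pos.2 hα).ne'] at this
    simpa using h1.const_mul (6 * (C : ℝ))
  have hosc := uniformly_cauchy_of_modulus (O := B') hPc hω hkey
  have hvc : ∀ t ∈ T, ContinuousOn (vT t) B' := fun t ht =>
    ((hvT t ht).1.continuousOn hα).mono hB'B
  obtain ⟨W, hWc, hWT⟩ := exists_continuousOn_of_uniformly_cauchy_slices hTI hTcl hvc hosc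
  -- Step 6: the quantitative time modulus on the good set
  have hvolBB : (volume B).toReal = VB := by
    rw [hVB, hB, Measure.addHaar_ball_center]
  have hAn : ∀ n, A n ≤ A₀ / δ n ^ 5 := by
    intro n
    have hd := hδ0 n
    have hd4 : δ n ^ 5 ≤ δ n ^ 4 := pow_le_pow_of_le_one hd.le (hδ1 n) (by norm_num)
    have hK₁n : 0 ≤ K₁ n := by rw [hK₁d]; positivity
    have hK₂n : 0 ≤ K₂ n := by rw [hK₂d]; positivity
    have hK₁le : K₁ n ≤ k₁ / δ n ^ 5 := div_le_div_of_nonneg_left hk₁ (by positivity) hd4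
    have hK₂e : K₂ n = k₂ / δ n ^ 5 := rfl
    have h1 : |(volume B).toReal * (K₁ n * M ^ 2 + K₂ n * M)| ≤
        VB * (k₁ / δ n ^ 5 * M ^ 2 + k₂ / δ n ^ 5 * |M|) := by
      rw [hvolBB, abs_mul, abs_of_nonneg hvolB]
      refine mul_le_mul_of_nonneg_left ?_ hvolB
      calc |K₁ n * M ^ 2 + K₂ n * M| ≤ |K₁ n * M ^ 2| + |K₂ n * M| := abs_add_le _ _
        _ = K₁ n * M ^ 2 + K₂ n * |M| := by
            rw [abs_mul, abs_mul, abs_of_nonneg hK₁n, abs_of_nonneg hK₂n, abs_of_nonneg (sq_nonneg M)]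
        _ ≤ k₁ / δ n ^ 5 * M ^ 2 + k₂ / δ n ^ 5 * |M| := by rw [hK₂e]; gcongr
    have h2 : 3 * |K₁ n| ≤ 3 * (k₁ / δ n ^ 5) := by rw [abs_of_nonneg hK₁n]; linarith
    calc A n ≤ VB * (k₁ / δ n ^ 5 * M ^ 2 + k₂ / δ n ^ 5 * |M|) + 3 * (k₁ / δ n ^ 5) :=
          add_le_add h1 h2
      _ = A₀ / δ n ^ 5 := by rw [hA₀]; field_simp
  have hkey' : ∀ n : ℕ, ∀ t ∈ T, ∀ s ∈ T, ∀ y ∈ B',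
      ‖vT t y - vT s y‖ ≤ 6 * C * (δ₀ / ((n : ℝ) + 1)) ^ (α : ℝ) +
        3 * (A₀ / (δ₀ / ((n : ℝ) + 1)) ^ 5) * |P t - P s| := by
    intro n t ht s hs y hy
    have h := hkey n t ht s hs y hy
    have hsumA : (∑ _i : Fin 3, A n) = 3 * A n := by simp
    rw [hsumA] at h
    have hδn : δ n = δ₀ / ((n : ℝ) + 1) := rfl
    rw [← hδn]
    have h2 : 3 * A n * |P t - P s| ≤ 3 * (A₀ / δ n ^ 5) * |P t - P s| := by
      gcongr; exact hAn n
    linarith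
  have hΛle : ((∫⁻ w in parabolicCylinderCentered R z, ‖p w.1 w.2‖ₑ ^ (3 / 2 : ℝ)) ^ (2 / 3 : ℝ) *
      volume (ball z.2 R) ^ (1 / 3 : ℝ)).toReal ≤ Λ := by
    rw [hΛ, Measure.addHaar_ball_center volume z.2 R]
    refine ENNReal.toReal_mono ?_ ?_
    · exact ENNReal.mul_ne_top (ENNReal.rpow_ne_top_of_nonneg (by norm_num) ENNReal.coe_ne_top)
        (ENNReal.rpow_ne_top_of_nonneg (by norm_num) measure_ball_lt_top.ne)
    · gcongr
  have hPmod : ∀ t ∈ T, ∀ s ∈ T, |P t - P s| ≤ |t - s| + Λ * |t - s| ^ (1 / 3 : ℝ) := by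
    intro t ht s hs
    refine (abs_pressureClock_sub_le hp hpi (Ioo_subset_Icc_self hs.1)
      (Ioo_subset_Icc_self ht.1)).trans ?_
    gcongr
  have htime := time_modulus_of_scales_explicit (B' := B') hδ₀0 hδ₀1 hA₀0 hΛ0 hkey' hPmod
    (fun t ht y hy => hvM t ht y (hB'B hy))
  -- Step 7: the Hölder bound for the product metric, and the a.e. equality
  have hspace : ∀ t ∈ T, ∀ y ∈ B', ∀ y' ∈ B', ‖vT t y - vT t y'‖ ≤ C * dist y y' ^ (α : ℝ) := by
    intro t ht y hy y' hy'
    rw [← dist_eq_norm]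
    exact (hvT t ht).1.dist_le (hB'B hy) (hB'B hy')
  refine ⟨W, ?_, ?_⟩
  · exact holderOnWith_of_dense_bounds hTI hTcl hWc hWT hκ0 hκα hKt0 htime hspace
      (fun t ht y hy => hvM t ht y (hB'B hy))
  · refine ae_eq_restrict_prod_of_ae_ae ?_ ?_ ?_
    · have hsub : Ioo a b ×ˢ B' ⊆ parabolicCylinderCentered R z := prod_mono Subset.rfl hB'B
      exact (hsol.1.mono_set hsub).aestronglyMeasurable
    · exact hWc.aestronglyMeasurable (measurableSet_Ioo.prod measurableSet_ball)
    · filter_upwards [hTfull] with t ht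
      filter_upwards [ae_restrict_of_ae_restrict_of_subset hB'B (hvT t ht).2,
        ae_restrict_mem measurableSet_ball] with y hy hyB'
      simp only [uncurry_apply_pair]
      rw [hWT t ht y hyB', hy]

end SliceTimeHolderQuant

end Literature.Analysis.FluidPDE

end
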